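import Summits.QuantumFields.YangMills.Theorems.BalabanUVNodesN09AveragingOpenAtSmallFields
import Summits.QuantumFields.YangMills.Theorems.BalabanUVNodesN09NestingOfHierAxial

/-!
# NODE N09 [B12] — ONE-BOND PARAMETRIC OPENNESS: for every environment `z` near a guarded `z₀` the equation `Ū(z[β(c) ↦ g])(c) = Ū(z₀)(c)` has a solution `g`
# near `z₀(β(c))` — the (O) socket of dag-n09-w6 g4's `…TowerBasePointSocketsOfOpenness` by the submersion open-mapping (block-triangular onto derivative), not the IFT

Cell `pub-ymgap` (YM-PLAN Track A), seat `pub-ymgap-dag-n09-w1` g6 (D-0149 width seat 1 of node N09 [B12] = [Balaban1987RG1]); count-neutral helper of the K1-face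
(`--supports stmt-QuantumFields-27364 --as helper`).  [I] = [Balaban1987RG1] (CMP 109), [B7] = [Balaban1985Averaging] (CMP 98), [B11] = [Balaban1985Variational].

WHY.  dag-n09-w6 g4's `…TowerBasePointSocketsOfOpenness` reduces the road-A′ tower's base-point sockets `hΦc` ∕ `hJpos` (dag-n09-w5 g4) to ONE displayed input, (O):
`∀ V ∈ domAlt_{j+1}, ∀ c, {z | V c ∈ T c z} ∈ 𝓝 (critCfgOfRecord … j V)` with the image windows `T c U = (g ↦ Ū(U[β(c) ↦ g])(c)) '' Ω c U` of the one-bond maps over the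
private coordinate `β(c)` (`BlockAveragingHaarAC.centralBond`) — «the implicit-function face»: [I] p. 267 «B′(b₀(c)) can be expressed in terms of the remaining variables».  THIS FILE
proves it WITHOUT an implicit function: the JOINT map `J : (z, g) ↦ (z, Ū(z[β(c) ↦ g])(c))` read in the product exponential charts at `(z₀, z₀(β(c)))` is
`(A, X) ↦ (A, ψ_{z₀}(A + δ_{β(c)}(X − A_{β(c)}))(c))` — dag-n09-w4's chart read `ψ_{z₀}` (`…N09ChartReadAveragingSmooth.contDiffAt_chartRead_avgFun`) precomposed with a
continuous linear substitution, because `(Θ^B(A)·z₀)[β(c) ↦ Θ(X)·z₀(β(c))] = Θ^B(A + δ_{β(c)}(X − A_{β(c)}))·z₀` — whose strict derivative at `0` is block-triangular with the ONTO block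
`X ↦ (Dψ_{z₀}(0)[X δ_{β(c)}])(c)` (dag-n09-w4 `exists_fderiv_chartRead_single_eq_single`, i.e. dag-n07-w2's onto central response), hence ONTO; so `J` maps neighbourhoods of the base
point onto neighbourhoods of `(z₀, Ū(z₀)(c))` (Mathlib `HasStrictFDerivAt.map_nhds_eq_of_surj`), and for EVERY neighbourhood `W` of `(z₀, z₀(β(c)))` the environments `z` admitting a
solution `g` of `Ū(z[β(c) ↦ g])(c) = Ū(z₀)(c)` with `(z, g) ∈ W` form a neighbourhood of `z₀` (chart transport: this seat's `…N09AveragingOpenAtSmallFields` §1).  Taking `W` = the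
window graph gives (O) whenever the base point is INTERIOR to the windows; at the record (`z₀ = V^{(j)}(V)`, `Ū(z₀) = V` on the solvable set) this is (O) verbatim modulo that
interiority (dag-n09-w6 g4's `continuous_centralWindowFamily` + strict smallness of the base letters — their lane) and the guards.

WHAT IS PROVED (theorems only, 0 `def`, 0 `sorry`).
§1 `piExpChart_translate_update` (the update identity) · ★★★ `oneBond_solution_nhds_of_loopSmall` — generic torus `P`, level `j`, `j+1 ≤ m+K`, `z₀` in the loop α′-guard
   (`∀ c i, |z₀(loop) − 1| ≤ α′`, `α′ ≤ 1∕24`, `α′ < δ_N`, `157·α′ < L^{1−d}` — dag-n09-w4's hypotheses verbatim), ANY `W ∈ 𝓝 (z₀, z₀(β c))`: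
   `{z | ∃ g, (z, g) ∈ W ∧ Ū(z[β c ↦ g])(c) = Ū(z₀)(c)} ∈ 𝓝 z₀`.
§2 ★★ `image_window_mem_nhds_of_loopSmall` — for ANY window family `Ω : GaugeField → Set (SU N)` whose graph is a neighbourhood of `(z₀, z₀(β c))`:
   `{z | Ū(z₀)(c) ∈ (g ↦ Ū(z[β c ↦ g])(c)) '' Ω z} ∈ 𝓝 z₀` — the (O) shape with `T c z` unfolded.
§3 `loopHol_critCfgOfRecord_le` (the guard at `V^{(j)}(V)` from [B7] Prop. 2) · ★★★ `hopen_domAlt_of_windowInterior_of_hsolν` — AT THE RECORD (`K`-th torus, `j < K`): for `V ∈ domAlt_{j+1}` with the level-`(j+1)` problem solvable at `ν.εreg` (`hsolν`), the Prop-2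
   numerics (`0 < εreg`, `C₀εreg ≤ ⅓`, `2εreg ≤ c′₂`) and the chart guard `(((d+2)L)²∕4)·(2εreg∕L²) ≤ α′` (`α′` as in §1), and ANY window family whose graph is a neighbourhood of
   `(V^{(j)}(V), V^{(j)}(V)(β c))` for every `c` (displayed `hwin`): `∀ c, {z | V c ∈ (g ↦ Ū(z[β c ↦ g])(c)) '' Ω c z} ∈ 𝓝 (critCfgOfRecord F N ν K j V)` — dag-n09-w6 g4's (O) with
   `T c U := (g ↦ Ū(U[β c ↦ g])(c)) '' Ω c U`, modulo the window-interiority `hwin` only.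

HONEST FRAMING.  Count-neutral kernel calculus ∕ topology on the tree's OWN (0.4) averaging, through dag-n09-w4's landed chart-read theorems BY NAME; NOTHING of Bałaban's asserted;
[B11] solvability `hsolν`, the window interiority `hwin` and the numerics stay DISPLAYED; NO window ∕ chart of record constructed or re-pointed; w5's sockets NOT discharged by this
file alone ((P), `hwin`, w6's composition remain theirs); `hreg` ∕ N09 NOT discharged; conjunct 1 (Lemma 4) ∕ FLAG №7 untouched; K0⁷ ∕ K1⁹ ∕ K3⁸ NOT closed; counts unmoved (typed 28∕28 ·
discharged 5∕28); one finite four-torus programme at fixed `ε = L^{−K}` per run — R4 closes the conditional rung `BalabanLadder.UV` only; NOT ℝ⁴ ∕ infinite volume ∕ OS; the Yang–Mills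
mass gap (Clay) is NOT proved by any of this.
-/

noncomputable section

open scoped Matrix.Norms.L2Operator Topology
open Set Filter Function

namespace Summit.QuantumFields.YangMills.BalabanUVNodes.N09OneBondParametricOpenness

open Literature.MathematicalPhysics.QuantumFieldTheory.Balaban1983to89
open Literature.MathematicalPhysics.QuantumFieldTheory.Balaban1983to89.T4Continuum (T4Family)
open Literature.MathematicalPhysics.QuantumFieldTheory.Balaban1983to89.HaarExponentialChart
open Literature.MathematicalPhysics.QuantumFieldTheory.Balaban1983to89.HaarExponentialChart.IsChartRep
open Literature.MathematicalPhysics.QuantumFieldTheory.Balaban1983to89.BlockAveraging (Small Idx avgFun loopHol)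
open Literature.MathematicalPhysics.QuantumFieldTheory.Balaban1983to89.BlockAveragingHaarAC (centralBond)
open Literature.MathematicalPhysics.QuantumFieldTheory.Balaban1983to89.ExpMeanLog (expMeanLogSU deltaSU)
open Literature.MathematicalPhysics.QuantumFieldTheory.Balaban1983to89.Node00
open Literature.MathematicalPhysics.QuantumLattice (fundamentalRep)
open Summit.QuantumFields.YangMills.BalabanUVNodes.N09ChartReadAveragingSmooth (contDiffAt_chartRead_avgFun continuousAt_avgFun_of_small piExpChart_translate_zero)
open Summit.QuantumFields.YangMills.BalabanUVNodes.N09ChartReadAveragingSubmersion (exists_fderiv_chartRead_single_eq_single)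
open Summit.QuantumFields.YangMills.BalabanUVNodes.N09AveragingOpenAtSmallFields (nhds_le_map_piExpChart_mulRight)
open Summit.QuantumFields.YangMills.BalabanUVNodes.N09NestingOfHierAxial (hcrit_of_ukExists)

/-! ## §1 The joint one-bond map is open at a guarded base point -/

section Generic

variable {P : Params} {j : ℕ} {N : ℕ} [NeZero N]

/-- **The update identity**: translating the one-bond update `A[β ↦ X]` of a product chart point by `z₀` is the one-bond update of `Θ^B(A)·z₀` at `β` by `Θ(X)·z₀(β)`.
[cite: Helgason2000, Ch. I §1 Thm. 1.14 (13) p. 96 (bookkeeping)] -/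
theorem piExpChart_translate_update (z₀ : GaugeField P j (SU N)) (β : PBond P j) (A : (PBond P j → (specialUnitaryLogChart (Fin N)).lie)) (X : (specialUnitaryLogChart (Fin N)).lie) :
    (fun b => (isChartRep_specialUnitaryGroup (n := Fin N)).expChart (Function.update A β X b) * z₀ b) =
      Function.update (fun b => (isChartRep_specialUnitaryGroup (n := Fin N)).expChart (A b) * z₀ b) β
        ((isChartRep_specialUnitaryGroup (n := Fin N)).expChart X * z₀ β) := by
  funext b
  by_cases hb : b = β
  · subst hb
    rw [Function.update_self, Function.update_self]
  · rw [Function.update_of_ne hb, Function.update_of_ne hb]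

/-- ★★★ **ONE-BOND PARAMETRIC OPENNESS.**  Let `z₀` be a level-`j` configuration in the loop `α′`-guard (`j + 1 ≤ m + K`, `α′ ≤ 1∕24`, `α′ < δ_N`, `157·α′ < L^{1−d}`) and `c` a coarse
bond with private coordinate `β(c)`.  For EVERY neighbourhood `W` of `(z₀, z₀(β c))`, the set of environments `z` for which SOME `g` with `(z, g) ∈ W` solves
`Ū(z[β c ↦ g])(c) = Ū(z₀)(c)` is a neighbourhood of `z₀`.  (Submersion open-mapping on the joint map `(z, g) ↦ (z, Ū(z[β c ↦ g])(c))`, encoded on the single chart space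
`𝔰𝔲(N)^{B_j ⊔ {∗}}`: its chart read is dag-n09-w4's `ψ_{z₀}` after the linear substitution `B ↦ (b ↦ B(if b = β c then ∗ else b))`, with block-triangular onto derivative.)
[cite: Balaban1987RG1, (0.4) p.253 and (2.10) p.267; Balaban1985Averaging, Prop. 3 (122)–(124) p.36] -/
theorem oneBond_solution_nhds_of_loopSmall {z₀ : GaugeField P j (SU N)} (hj : j + 1 ≤ P.m + P.K) {α : ℝ}
    (hα : ∀ c i, dist1 (loopHol z₀ c i) ≤ α) (hα24 : α ≤ 1 / 24) (hαδ : α < deltaSU (Fin N)) (hαL : 157 * α < ((P.L : ℝ) ^ (P.d - 1))⁻¹)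
    (c : PBond P (j + 1)) {W : Set (GaugeField P j (SU N) × SU N)} (hW : W ∈ 𝓝 (z₀, z₀ (centralBond c))) :
    {z : GaugeField P j (SU N) | ∃ g : SU N, (z, g) ∈ W ∧
      avgFun (expMeanLogSU (n := Fin N)) (Function.update z (centralBond c) g) c = avgFun (expMeanLogSU (n := Fin N)) z₀ c} ∈ 𝓝 z₀ := by
  classical
  have h : IsChartRep (specialUnitaryLogChart (Fin N)) (fundamentalRep (Fin N)) := isChartRep_specialUnitaryGroup (n := Fin N)
  have hsmall : ∀ c, Small (expMeanLogSU (n := Fin N)) z₀ c := fun c i => lt_of_le_of_lt (hα c i) hαδ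
  -- opaque names: the in-charts, dag-n09-w4's chart read, the re-indexing substitution, the embedding and the joint map
  obtain ⟨Λin, hΛin⟩ : ∃ f : (PBond P j → (specialUnitaryLogChart (Fin N)).lie) → GaugeField P j (SU N), f = fun A b => h.expChart (A b) * z₀ b := ⟨_, rfl⟩
  obtain ⟨lam, hlam⟩ : ∃ f : (specialUnitaryLogChart (Fin N)).lie → SU N, f = fun X => h.expChart X * z₀ (centralBond c) := ⟨_, rfl⟩
  obtain ⟨ψ, hψ⟩ : ∃ f : (PBond P j → (specialUnitaryLogChart (Fin N)).lie) → (PBond P (j + 1) → (specialUnitaryLogChart (Fin N)).lie),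
      f = fun A c' => h.logChart (avgFun (expMeanLogSU (n := Fin N)) (fun b => h.expChart (A b) * z₀ b) c' * (avgFun (expMeanLogSU (n := Fin N)) z₀ c')⁻¹) := ⟨_, rfl⟩
  obtain ⟨sel, hsel⟩ : ∃ f : PBond P j → Option (PBond P j), f = fun b => if b = centralBond c then none else some b := ⟨_, rfl⟩
  obtain ⟨Lsub, hLfun⟩ : ∃ f : (Option (PBond P j) → (specialUnitaryLogChart (Fin N)).lie) → (PBond P j → (specialUnitaryLogChart (Fin N)).lie), f = fun B b => B (sel b) := ⟨_, rfl⟩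
  obtain ⟨Lclm, hLclm⟩ : ∃ Lm, Lm = Pi.compRightL ℝ (fun _ : Option (PBond P j) => (specialUnitaryLogChart (Fin N)).lie) sel := ⟨_, rfl⟩
  have hLsub : ∀ B b, Lsub B b = B (sel b) := fun B b => by rw [hLfun]
  have hLclm_eq : ∀ B, Lclm B = Lsub B := fun B => by rw [hLfun, hLclm]; rfl
  obtain ⟨emb, hemb⟩ : ∃ f : (PBond P j → (specialUnitaryLogChart (Fin N)).lie) → (specialUnitaryLogChart (Fin N)).lie → (Option (PBond P j) → (specialUnitaryLogChart (Fin N)).lie), f = fun A X o => Option.elim o X A := ⟨_, rfl⟩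
  obtain ⟨G, hG⟩ : ∃ f : (Option (PBond P j) → (specialUnitaryLogChart (Fin N)).lie) → (Option (PBond P j) → (specialUnitaryLogChart (Fin N)).lie), f = fun B o => Option.elim o (ψ (Lsub B) c) (fun b => B (some b)) := ⟨_, rfl⟩
  -- algebra of the substitution
  have hsel_β : sel (centralBond c) = none := by rw [hsel]; simp
  have hsel_ne : ∀ {b}, b ≠ centralBond c → sel b = some b := fun hb => by rw [hsel]; simp [hb]
  have hLsub_emb : ∀ A X, Lsub (emb A X) = Function.update A (centralBond c) X := by
    intro A X; funext b
    rw [hLsub, hemb]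
    by_cases hb : b = centralBond c
    · subst hb; rw [hsel_β, Function.update_self]; rfl
    · rw [hsel_ne hb, Function.update_of_ne hb]; rfl
  have hemb_add : ∀ A X, emb A X = emb A 0 + emb 0 X := by
    intro A X; rw [hemb]; funext o; cases o <;> simp
  have hLsub_single : ∀ X, Lsub (emb 0 X) = Pi.single (centralBond c) X := by
    intro X; rw [hLsub_emb]; rfl
  have hL0 : Lsub 0 = 0 := by rw [← hLclm_eq]; exact map_zero Lclm
  -- basic values
  have hΛin0 : Λin 0 = z₀ := by rw [hΛin]; exact piExpChart_translate_zero (P := P) (j := j) z₀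
  have hlam0 : lam 0 = z₀ (centralBond c) := by rw [hlam]; simp only [h.expChart_zero, one_mul]
  have hψ0 : ψ 0 = 0 := by
    rw [hψ]; funext c'
    show h.logChart (avgFun (expMeanLogSU (n := Fin N)) (fun b => h.expChart ((0 : (PBond P j → (specialUnitaryLogChart (Fin N)).lie)) b) * z₀ b) c' * (avgFun (expMeanLogSU (n := Fin N)) z₀ c')⁻¹) = 0
    rw [piExpChart_translate_zero, mul_inv_cancel, N09AveragingOpenAtSmallFields.logChart_one]
  have hG0 : G 0 = 0 := by
    rw [hG]; funext o; cases o
    · show ψ (Lsub 0) c = 0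
      rw [hL0, hψ0]; rfl
    · rfl
  -- Step 1: strict derivative of `G` at `0`, coordinate by coordinate
  have hψstrict : HasStrictFDerivAt ψ (fderiv ℝ ψ 0) 0 := by
    have hcd : ContDiffAt ℝ ⊤ ψ 0 := by rw [hψ]; exact contDiffAt_chartRead_avgFun (P := P) (j := j) z₀ hsmall
    exact hcd.hasStrictFDerivAt (by simp)
  have h1 : HasStrictFDerivAt ψ (fderiv ℝ ψ 0) (Lsub 0) := by rw [hL0]; exact hψstrict
  have hLder : HasStrictFDerivAt Lsub Lclm 0 := by
    rw [hLfun, hLclm]; exact (Pi.compRightL ℝ (fun _ : Option (PBond P j) => (specialUnitaryLogChart (Fin N)).lie) sel).hasStrictFDerivAt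
  -- (the chain rule is invoked in `@`-form: with the point explicit the elaborator otherwise postpones `hg` and loses the middle space)
  have hcomp : HasStrictFDerivAt (fun B : (Option (PBond P j) → (specialUnitaryLogChart (Fin N)).lie) => ψ (Lsub B)) ((fderiv ℝ ψ 0).comp Lclm) 0 :=
    @HasStrictFDerivAt.comp ℝ _ (Option (PBond P j) → (specialUnitaryLogChart (Fin N)).lie) _ _ (PBond P j → (specialUnitaryLogChart (Fin N)).lie) _ _ (PBond P (j + 1) → (specialUnitaryLogChart (Fin N)).lie) _ _ Lsub Lclm (0 : (Option (PBond P j) → (specialUnitaryLogChart (Fin N)).lie)) ψ (fderiv ℝ ψ 0) h1 hLder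
  have hprojder : HasStrictFDerivAt (fun W : (PBond P (j + 1) → (specialUnitaryLogChart (Fin N)).lie) => W c)
      (ContinuousLinearMap.proj (R := ℝ) (φ := fun _ : PBond P (j + 1) => (specialUnitaryLogChart (Fin N)).lie) c) (ψ (Lsub 0)) :=
    (ContinuousLinearMap.proj (R := ℝ) (φ := fun _ : PBond P (j + 1) => (specialUnitaryLogChart (Fin N)).lie) c).hasStrictFDerivAt
  have hnone : HasStrictFDerivAt (fun B : (Option (PBond P j) → (specialUnitaryLogChart (Fin N)).lie) => ψ (Lsub B) c) ((ContinuousLinearMap.proj c).comp ((fderiv ℝ ψ 0).comp Lclm)) 0 :=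
    @HasStrictFDerivAt.comp ℝ _ (Option (PBond P j) → (specialUnitaryLogChart (Fin N)).lie) _ _ (PBond P (j + 1) → (specialUnitaryLogChart (Fin N)).lie) _ _ (specialUnitaryLogChart (Fin N)).lie _ _ (fun B : (Option (PBond P j) → (specialUnitaryLogChart (Fin N)).lie) => ψ (Lsub B)) ((fderiv ℝ ψ 0).comp Lclm) (0 : (Option (PBond P j) → (specialUnitaryLogChart (Fin N)).lie))
      (fun W : (PBond P (j + 1) → (specialUnitaryLogChart (Fin N)).lie) => W c) (ContinuousLinearMap.proj (R := ℝ) (φ := fun _ : PBond P (j + 1) => (specialUnitaryLogChart (Fin N)).lie) c) hprojder hcomp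
  obtain ⟨G', hG'⟩ : ∃ Gd, Gd = ContinuousLinearMap.pi fun o : Option (PBond P j) =>
      Option.elim o ((ContinuousLinearMap.proj c).comp ((fderiv ℝ ψ 0).comp Lclm))
        (fun b => ContinuousLinearMap.proj (R := ℝ) (φ := fun _ : Option (PBond P j) => (specialUnitaryLogChart (Fin N)).lie) (some b)) := ⟨_, rfl⟩
  have hG'_apply : ∀ B o, G' B o = Option.elim o ((fderiv ℝ ψ 0 (Lsub B)) c) (fun b => B (some b)) := by
    intro B o; rw [hG', ← hLclm_eq]; cases o <;> rfl
  have hGder : HasStrictFDerivAt G G' 0 := by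
    rw [hG, hG']
    refine (hasStrictFDerivAt_pi (𝕜 := ℝ) (F' := fun _ : Option (PBond P j) => (specialUnitaryLogChart (Fin N)).lie)
      (φ := fun o B => Option.elim o (ψ (Lsub B) c) (fun b => B (some b)))
      (φ' := fun o : Option (PBond P j) => Option.elim o ((ContinuousLinearMap.proj c).comp ((fderiv ℝ ψ 0).comp Lclm))
        (fun b => ContinuousLinearMap.proj (R := ℝ) (φ := fun _ : Option (PBond P j) => (specialUnitaryLogChart (Fin N)).lie) (some b)))).2 fun o => ?_
    cases o with
    | none => exact hnone
    | some b => exact (ContinuousLinearMap.proj (R := ℝ) (φ := fun _ : Option (PBond P j) => (specialUnitaryLogChart (Fin N)).lie) (some b)).hasStrictFDerivAt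
  -- Step 2: the derivative is onto (block-triangular with the ONTO one-bond block of dag-n09-w4)
  have hsurj : Function.Surjective G' := by
    intro Y
    obtain ⟨Z, hZ⟩ : ∃ Z : (specialUnitaryLogChart (Fin N)).lie, Z = Y none - (fderiv ℝ ψ 0 (Lsub (emb (fun b => Y (some b)) 0))) c := ⟨_, rfl⟩
    obtain ⟨X', hX⟩ := exists_fderiv_chartRead_single_eq_single (P := P) (j := j) hj hα hα24 hαδ hαL c Z
    have hX' : fderiv ℝ ψ 0 (Pi.single (centralBond c) X') = Pi.single c Z := by
      have hfd : fderiv ℝ ψ 0 = fderiv ℝ (fun (A : (PBond P j → (specialUnitaryLogChart (Fin N)).lie)) (c' : PBond P (j + 1)) =>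
          h.logChart (avgFun (expMeanLogSU (n := Fin N)) (fun b => h.expChart (A b) * z₀ b) c' * (avgFun (expMeanLogSU (n := Fin N)) z₀ c')⁻¹)) 0 := by rw [hψ]
      rw [hfd]; exact hX
    have hLsub_add : ∀ B B' : (Option (PBond P j) → (specialUnitaryLogChart (Fin N)).lie), Lsub (B + B') = Lsub B + Lsub B' := fun B B' => by rw [hLfun]; rfl
    refine ⟨emb (fun b => Y (some b)) X', funext fun o => ?_⟩
    show G' (emb (fun b => Y (some b)) X') o = Y o
    rw [hG'_apply]
    cases o with
    | none =>
      show (fderiv ℝ ψ 0 (Lsub (emb (fun b => Y (some b)) X'))) c = Y none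
      rw [hemb_add _ X', hLsub_add, map_add, Pi.add_apply, hLsub_single, hX', Pi.single_eq_same, hZ]
      abel
    | some b =>
      show emb (fun b => Y (some b)) X' (some b) = Y (some b)
      rw [hemb]; rfl
  -- Step 3: `G` is open at `0`
  haveI : CompleteSpace (specialUnitaryLogChart (Fin N)).lie := FiniteDimensional.complete ℝ _
  have hGopen : map G (𝓝 0) = 𝓝 0 := by
    have := HasStrictFDerivAt.map_nhds_eq_of_surj (𝕜 := ℝ) (E := (Option (PBond P j) → (specialUnitaryLogChart (Fin N)).lie)) (F := (Option (PBond P j) → (specialUnitaryLogChart (Fin N)).lie))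
      (f := G) (f' := G') (a := 0) hGder (by rw [LinearMap.range_eq_top]; exact hsurj)
    rwa [hG0] at this
  -- Step 4: the «good» neighbourhood of `0`: inside `W` after the charts, and inside the log chart's honesty window at `c`
  have hΛcont : Continuous Λin := by
    rw [hΛin]; exact continuous_pi fun b => (h.continuous_expChart.comp (continuous_apply b)).mul continuous_const
  have hlamcont : Continuous lam := by rw [hlam]; exact h.continuous_expChart.mul continuous_const
  have hrestr : Continuous fun B : (Option (PBond P j) → (specialUnitaryLogChart (Fin N)).lie) => (fun b => B (some b) : (PBond P j → (specialUnitaryLogChart (Fin N)).lie)) := continuous_pi fun b => continuous_apply (some b)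
  have hgood1 : {B : (Option (PBond P j) → (specialUnitaryLogChart (Fin N)).lie) | (Λin (fun b => B (some b)), lam (B none)) ∈ W} ∈ 𝓝 (0 : (Option (PBond P j) → (specialUnitaryLogChart (Fin N)).lie)) := by
    have hc : ContinuousAt (fun B : (Option (PBond P j) → (specialUnitaryLogChart (Fin N)).lie) => ((Λin (fun b => B (some b)), lam (B none)) : GaugeField P j (SU N) × SU N)) 0 :=
      ((hΛcont.comp hrestr).prodMk (hlamcont.comp (continuous_apply none))).continuousAt
    refine hc.preimage_mem_nhds ?_
    show W ∈ 𝓝 (Λin (fun b => (0 : (Option (PBond P j) → (specialUnitaryLogChart (Fin N)).lie)) (some b)), lam ((0 : (Option (PBond P j) → (specialUnitaryLogChart (Fin N)).lie)) none))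
    rw [show (fun b => (0 : (Option (PBond P j) → (specialUnitaryLogChart (Fin N)).lie)) (some b)) = (0 : (PBond P j → (specialUnitaryLogChart (Fin N)).lie)) from rfl, show (0 : (Option (PBond P j) → (specialUnitaryLogChart (Fin N)).lie)) none = 0 from rfl, hΛin0, hlam0]
    exact hW
  have hcont_avg : ContinuousAt (avgFun (expMeanLogSU (n := Fin N)) : GaugeField P j (SU N) → GaugeField P (j + 1) (SU N)) z₀ :=
    continuousAt_avgFun_of_small (P := P) (j := j) z₀ hsmall
  have hgood2 : {B : (Option (PBond P j) → (specialUnitaryLogChart (Fin N)).lie) | ‖fundamentalRep (Fin N) (avgFun (expMeanLogSU (n := Fin N)) (Λin (Lsub B)) c * (avgFun (expMeanLogSU (n := Fin N)) z₀ c)⁻¹) - 1‖ <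
      innerRadius (specialUnitaryLogChart (Fin N))} ∈ 𝓝 (0 : (Option (PBond P j) → (specialUnitaryLogChart (Fin N)).lie)) := by
    have hLcont : Continuous Lsub := by rw [hLfun]; exact continuous_pi fun b => continuous_apply _
    have hin : ContinuousAt (fun B : (Option (PBond P j) → (specialUnitaryLogChart (Fin N)).lie) => Λin (Lsub B)) 0 := (hΛcont.comp hLcont).continuousAt
    have hin0 : Λin (Lsub 0) = z₀ := by rw [hL0, hΛin0]
    have hav : ContinuousAt (fun B : (Option (PBond P j) → (specialUnitaryLogChart (Fin N)).lie) => avgFun (expMeanLogSU (n := Fin N)) (Λin (Lsub B))) 0 := ContinuousAt.comp_of_eq hcont_avg hin hin0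
    have hF : ContinuousAt (fun B : (Option (PBond P j) → (specialUnitaryLogChart (Fin N)).lie) => ‖fundamentalRep (Fin N) (avgFun (expMeanLogSU (n := Fin N)) (Λin (Lsub B)) c * (avgFun (expMeanLogSU (n := Fin N)) z₀ c)⁻¹) - 1‖) 0 :=
      ((h.continuous.continuousAt.comp (((continuous_apply c).continuousAt.comp hav).mul continuousAt_const)).sub
        continuousAt_const).norm
    have h0 : ‖fundamentalRep (Fin N) (avgFun (expMeanLogSU (n := Fin N)) (Λin (Lsub 0)) c * (avgFun (expMeanLogSU (n := Fin N)) z₀ c)⁻¹) - 1‖ < innerRadius (specialUnitaryLogChart (Fin N)) := by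
      rw [hin0, mul_inv_cancel, map_one, sub_self, norm_zero]
      exact innerRadius_pos
    exact hF.eventually_lt continuousAt_const h0
  -- Step 5: the image of the good set is a neighbourhood of `0`; pull it back along `A ↦ emb A 0`
  have himg : G '' ({B : (Option (PBond P j) → (specialUnitaryLogChart (Fin N)).lie) | (Λin (fun b => B (some b)), lam (B none)) ∈ W} ∩
      {B : (Option (PBond P j) → (specialUnitaryLogChart (Fin N)).lie) | ‖fundamentalRep (Fin N) (avgFun (expMeanLogSU (n := Fin N)) (Λin (Lsub B)) c * (avgFun (expMeanLogSU (n := Fin N)) z₀ c)⁻¹) - 1‖ < innerRadius (specialUnitaryLogChart (Fin N))}) ∈ 𝓝 (0 : (Option (PBond P j) → (specialUnitaryLogChart (Fin N)).lie)) := by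
    rw [← hGopen]
    exact Filter.image_mem_map (Filter.inter_mem hgood1 hgood2)
  have hι : ContinuousAt (fun A : (PBond P j → (specialUnitaryLogChart (Fin N)).lie) => emb A 0) 0 := by
    rw [hemb]
    exact (continuous_pi fun o => by cases o with
      | none => exact continuous_const
      | some b => exact continuous_apply b).continuousAt
  have hemb0 : emb 0 0 = 0 := by rw [hemb]; funext o; cases o <;> rfl
  have hA := hι.preimage_mem_nhds (by rw [hemb0]; exact himg)
  -- Step 6: transport to the configuration space through `Λin` (open at `0` onto a neighbourhood of `z₀`)
  have hopenΛ : 𝓝 z₀ ≤ map Λin (𝓝 0) := by rw [hΛin]; exact nhds_le_map_piExpChart_mulRight z₀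
  refine mem_of_superset (hopenΛ (Filter.image_mem_map hA)) ?_
  rintro z ⟨A, hAmem, rfl⟩
  obtain ⟨B, ⟨hW₁, hhon⟩, hGB⟩ := hAmem
  -- `B` restricts to `A` on the old bonds and `ψ (Lsub B) c = 0`
  have hBA : (fun b => B (some b)) = A := by
    funext b
    have := congrFun hGB (some b)
    rw [hG, hemb] at this
    exact this
  have hψc : ψ (Lsub B) c = 0 := by
    have := congrFun hGB none
    rw [hG, hemb] at this
    exact this
  have hW₁' : (Λin A, lam (B none)) ∈ W := by
    have hW₁'' : (Λin (fun b => B (some b)), lam (B none)) ∈ W := hW₁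
    rwa [hBA] at hW₁''
  refine ⟨lam (B none), hW₁', ?_⟩
  -- the update is the translated substituted chart point
  have hLB : Lsub B = Function.update A (centralBond c) (B none) := by
    have := hLsub_emb (fun b => B (some b)) (B none)
    rw [hBA] at this
    rw [← this, hemb]
    congr 1; funext o; cases o with
    | none => rfl
    | some b => exact congrFun hBA b
  have hupd : Function.update (Λin A) (centralBond c) (lam (B none)) = Λin (Lsub B) := by
    rw [hLB, hΛin, hlam]
    exact (piExpChart_translate_update (P := P) (j := j) z₀ (centralBond c) A (B none)).symm
  rw [hupd]
  -- undo the log chart at `c`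
  have hψc' : h.logChart (avgFun (expMeanLogSU (n := Fin N)) (Λin (Lsub B)) c * (avgFun (expMeanLogSU (n := Fin N)) z₀ c)⁻¹) = 0 := by
    have := hψc
    rw [hψ] at this
    rw [hΛin]
    exact this
  have hexp := h.expChart_logChart hhon
  rw [hψc', h.expChart_zero] at hexp
  exact mul_inv_eq_one.1 hexp.symm

/-! ## §2 The (O) shape: the base value lies in the image window of every nearby environment -/

/-- ★★ **THE IMAGE WINDOWS OF NEARBY ENVIRONMENTS CONTAIN THE BASE VALUE.**  For ANY window family `Ω : GaugeField → Set (SU N)` whose graph `{(z, g) | g ∈ Ω z}` is a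
neighbourhood of `(z₀, z₀(β c))` (the base point is INTERIOR to the windows), the set of environments `z` with `Ū(z₀)(c) ∈ (g ↦ Ū(z[β c ↦ g])(c)) '' Ω z` is a
neighbourhood of `z₀` (guards as in §1). [cite: Balaban1987RG1, (0.4) p.253 and (2.10) p.267] -/
theorem image_window_mem_nhds_of_loopSmall {z₀ : GaugeField P j (SU N)} (hj : j + 1 ≤ P.m + P.K) {α : ℝ}
    (hα : ∀ c i, dist1 (loopHol z₀ c i) ≤ α) (hα24 : α ≤ 1 / 24) (hαδ : α < deltaSU (Fin N)) (hαL : 157 * α < ((P.L : ℝ) ^ (P.d - 1))⁻¹)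
    (c : PBond P (j + 1)) {Ω : GaugeField P j (SU N) → Set (SU N)}
    (hΩ : {p : GaugeField P j (SU N) × SU N | p.2 ∈ Ω p.1} ∈ 𝓝 (z₀, z₀ (centralBond c))) :
    {z : GaugeField P j (SU N) | avgFun (expMeanLogSU (n := Fin N)) z₀ c ∈
      (fun g => avgFun (expMeanLogSU (n := Fin N)) (Function.update z (centralBond c) g) c) '' Ω z} ∈ 𝓝 z₀ := by
  filter_upwards [oneBond_solution_nhds_of_loopSmall hj hα hα24 hαδ hαL c hΩ] with z hz
  obtain ⟨g, hg, hgeq⟩ := hz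
  exact ⟨g, hg, hgeq⟩

end Generic

/-! ## §3 At the record: dag-n09-w6 g4's (O) socket modulo the interiority of the base point in the windows -/

section Record

variable {F : T4Family} {N : ℕ} [NeZero N]

/-- The loop letters of the critical configuration of a solvable small field are within `(((d+2)L)²∕4)·(2εreg∕L²)` of `1` ([B7] Prop. 2 smallness of `V^{(j)}`, dag-n09-w1 g2
`hcrit_of_ukExists`, + `LatticeWordStokes.dist1_loopHol_le`). [cite: Balaban1985Averaging, Prop. 2 (53) p.26; Balaban1987RG1, (0.4) p.253] -/
theorem loopHol_critCfgOfRecord_le (ν : Stage7Numerics) {K j : ℕ} (hεreg : 0 < ν.εreg)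
    (hε3 : (143 * (((((F.P K).d + 4 : ℕ) : ℝ)) ^ 2 / 4) ^ 2) * ν.εreg ≤ 1 / 3)
    (hε2 : 2 * ν.εreg ≤ 2 * deltaSU (Fin N) / ((((F.P K).d + 4) * (F.P K).L : ℕ) : ℝ) ^ 2)
    {V : GaugeField (F.P K) (j + 1) (SU N)} (hV : UkExists F N K (j + 1) ν.εreg V) :
    ∀ c i, dist1 (loopHol (critCfgOfRecord F N ν K j V) c i) ≤ ((((F.P K).d + 2) * (F.P K).L : ℕ) : ℝ) ^ 2 / 4 * (2 * ν.εreg / ((F.P K).L : ℝ) ^ 2) := by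
  have hL0 : (0 : ℝ) < (F.P K).L := by have := (F.P K).L_pos; exact_mod_cast this
  have hδ : 2 * ν.εreg ≤ 2 * ν.εreg / ((F.P K).L : ℝ) ^ 2 * ((F.P K).L : ℝ) ^ 2 := by
    rw [div_mul_cancel₀ _ (pow_ne_zero 2 hL0.ne')]
  have hsmall : PlaqSmall (2 * ν.εreg / ((F.P K).L : ℝ) ^ 2) (critCfgOfRecord F N ν K j V) := hcrit_of_ukExists ν hεreg hε3 hε2 hδ hV
  exact fun c i => LatticeWordStokes.dist1_loopHol_le (by positivity) hsmall c i

/-- ★★★ **dag-n09-w6 g4's (O) SOCKET, MODULO THE INTERIORITY OF THE BASE POINT IN THE WINDOWS.**  On the `K`-th torus, at every step `j < K`: for every `V ∈ domAlt_{j+1}` at which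
the level-`(j+1)` problem is solvable at `ν.εreg` (`hsolν`), with the [B7] Prop-2 numerics and the chart guard `(((d+2)L)²∕4)·(2εreg∕L²) ≤ α′`, `α′ ≤ 1∕24`, `α′ < δ_N`,
`157·α′ < L^{1−d}`, and for ANY window family `Ω c : GaugeField → Set (SU N)` whose graph is a neighbourhood of `(V^{(j)}(V), V^{(j)}(V)(β c))` for every `c` (displayed `hwin`:
the base point is interior to the windows — dag-n09-w6 g4's `continuous_centralWindowFamily` + strict smallness of the base letters):
`∀ c, {z | V c ∈ (g ↦ Ū(z[β c ↦ g])(c)) '' Ω c z} ∈ 𝓝 (critCfgOfRecord F N ν K j V)` — the `hopen` binder of `…TowerBasePointSocketsOfOpenness` with `T c U := (g ↦ Ū(U[β c ↦ g])(c)) '' Ω c U`.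
[cite: Balaban1987RG1, (2.3) p.265, (2.10) p.267, (0.4) p.253; Balaban1985Averaging, Prop. 2 (53) p.26 and Prop. 3 (122)–(124) p.36] -/
theorem hopen_domAlt_of_windowInterior_of_hsolν (ν : Stage7Numerics) {K j : ℕ} (hj : j < K) {α : ℝ}
    (hα24 : α ≤ 1 / 24) (hαδ : α < deltaSU (Fin N)) (hαL : 157 * α < (((F.P K).L : ℝ) ^ ((F.P K).d - 1))⁻¹)
    (hεreg : 0 < ν.εreg) (hε3 : (143 * (((((F.P K).d + 4 : ℕ) : ℝ)) ^ 2 / 4) ^ 2) * ν.εreg ≤ 1 / 3)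
    (hε2 : 2 * ν.εreg ≤ 2 * deltaSU (Fin N) / ((((F.P K).d + 4) * (F.P K).L : ℕ) : ℝ) ^ 2)
    (hαguard : ((((F.P K).d + 2) * (F.P K).L : ℕ) : ℝ) ^ 2 / 4 * (2 * ν.εreg / ((F.P K).L : ℝ) ^ 2) ≤ α)
    (hsolν : ∀ W ∈ domAltOfRecord F N ν K (j + 1), UkExists F N K (j + 1) ν.εreg W)
    (Ω : PBond (F.P K) (j + 1) → GaugeField (F.P K) j (SU N) → Set (SU N))
    (hwin : ∀ V ∈ domAltOfRecord F N ν K (j + 1), ∀ c,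
      {p : GaugeField (F.P K) j (SU N) × SU N | p.2 ∈ Ω c p.1} ∈ 𝓝 (critCfgOfRecord F N ν K j V, critCfgOfRecord F N ν K j V (centralBond c))) :
    ∀ V ∈ domAltOfRecord F N ν K (j + 1), ∀ c,
      {z : GaugeField (F.P K) j (SU N) | V c ∈ (fun g => (avOfRecord F N K j).avg (Function.update z (centralBond c) g) c) '' Ω c z} ∈
        𝓝 (critCfgOfRecord F N ν K j V) := by
  intro V hV c
  have hjK : j + 1 ≤ (F.P K).m + (F.P K).K := by
    rw [T4Family.P_K]
    have := (F.P K).m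
    omega
  have hguard : ∀ c' i, dist1 (loopHol (critCfgOfRecord F N ν K j V) c' i) ≤ α :=
    fun c' i => (loopHol_critCfgOfRecord_le ν hεreg hε3 hε2 (hsolν V hV) c' i).trans hαguard
  have h := image_window_mem_nhds_of_loopSmall (P := F.P K) (j := j) hjK hguard hα24 hαδ hαL c (hwin V hV c)
  have havg : avgFun (expMeanLogSU (n := Fin N)) (critCfgOfRecord F N ν K j V) c = V c := by
    have := avg_critCfgOfRecord (F := F) (N := N) (ν := ν) (K := K) (k := j) (hsolν V hV)
    exact congrFun this c
  rw [havg] at h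
  exact h

end Record

end Summit.QuantumFields.YangMills.BalabanUVNodes.N09OneBondParametricOpenness

end
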